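import Summits.Ventures.PercRepro.RankLevelSetPerElemThreeDual
import Summits.Ventures.PercRepro.RankLevelSetPerElemReduce

/-! # RankLevelSetStarPlusThreeSplit — THE ABSORBING PROFILE ACROSS A COLOOP, AND A TARGET THROUGH THE COMPLEMENT
OF EVERY ABSORBING `3`-SET (night-1 g36; dossier §48.9; on `RankLevelSetPerElemThreeDual` and `RankLevelSetPerElemReduce`)

Two ingredients of the reflection `i = 3` of (★★)⁺ (`RankLevelSetStarPlusThree`). A coloop `y` absorbs nothing
(`lowAbsorbCount_eq_zero_of_isColoop`); across a coloop `x ≠ y` the absorbing avoid-`y` profile splits as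
`A^y_{j+1}(M) = A^y_j(M ＼ {x}) + A^y_{j+1}(M ＼ {x})` (**`lowAbsorbCount_succ_of_coloop`**, from g35's
`ncard_biIndep_mem_coloop_eq` and `biIndep_filter_notMem_coloop`: the members through `x` are, minus `x`, the
members of `M ＼ {x}` one level down, the members avoiding `x` those of `M ＼ {x}` at the same level, and the
independence of `insert y Z` does not see the coloop). And every absorbing `3`-set `Z` has a TARGET through its
complement (**`exists_compl_pair_mem_lowAbsorb`**): a pair `T ⊆ E ∖ insert y Z` with `W := E ∖ insert y T ∈ A^y_{#E − 3}`
and `C_y(W) = C_y(Z)` — in the dual a basis of `J = E ∖ insert y Z` has at most two elements, extended inside `J`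
to a pair `T` with `cl✶ T = cl✶ J`, so `insert y T` spans `M✶`, `W ⊇ Z` spans, `T ⊆ J` does not, and the circuit
`C_y(Z) ⊆ insert y W` is the circuit of `y` in the independent `W`. Every declaration has a docstring; imports: the
cell's own modules and Mathlib only. Axioms: standard. -/

namespace PercRepro

open Set Matroid

variable {α : Type} (M : Matroid α) [M.Finite]


/-! ## Coloops -/

/-- A coloop `y` absorbs nothing: `insert y Z` is independent for every independent `Z`. -/
lemma lowAbsorbCount_eq_zero_of_isColoop {y : α} (hy : M.IsColoop y) (k : ℕ) : lowAbsorbCount M y k = 0 := by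
  unfold lowAbsorbCount
  rw [Set.ncard_eq_zero (lowAbsorbAt_finite M y k), Set.eq_empty_iff_forall_notMem]
  rintro Z ⟨⟨-, -, hZi, -⟩, -, hdep⟩
  exact hdep (hy.insert_indep_of_indep hZi)

/-- **The absorbing profile across a coloop `x ≠ y`**: `A^y_{j+1}(M) = A^y_j(M ＼ {x}) + A^y_{j+1}(M ＼ {x})`. -/
lemma lowAbsorbCount_succ_of_coloop {x y : α} (hx : M.IsColoop x) (hyx : y ≠ x) (j : ℕ) :
    lowAbsorbCount M y (j + 1) = lowAbsorbCount (M.delete {x}) y j + lowAbsorbCount (M.delete {x}) y (j + 1) := by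
  unfold lowAbsorbCount lowAbsorbAt
  have hfin : {Z ∈ biIndep M (j + 1) | y ∉ Z ∧ ¬ M.Indep (insert y Z)}.Finite :=
    (biIndep_finite M (j + 1)).subset (fun Z hZ => hZ.1)
  -- the independence of `insert y Z` does not see the coloop `x`
  have hind : ∀ Z, x ∉ insert y Z → (M.Indep (insert y Z) ↔ (M.delete {x}).Indep (insert y Z)) := by
    intro Z hxZ
    rw [Matroid.delete_indep_iff, Set.disjoint_singleton_right]
    exact ⟨fun h => ⟨h, hxZ⟩, fun h => h.1⟩
  have hsplit : {Z ∈ biIndep M (j + 1) | y ∉ Z ∧ ¬ M.Indep (insert y Z)} =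
      {Z ∈ biIndep M (j + 1) | x ∈ Z ∧ (y ∉ Z ∧ ¬ M.Indep (insert y Z))} ∪
        {Z ∈ biIndep (M.delete {x}) (j + 1) | y ∉ Z ∧ ¬ (M.delete {x}).Indep (insert y Z)} := by
    ext Z
    simp only [Set.mem_setOf_eq, Set.mem_union]
    constructor
    · rintro ⟨hZ, hyZ, hdep⟩
      by_cases hxZ : x ∈ Z
      · exact Or.inl ⟨hZ, hxZ, hyZ, hdep⟩
      · have hZ' : Z ∈ biIndep (M.delete {x}) (j + 1) := by
          rw [← biIndep_filter_notMem_coloop M hx (j + 1)]; exact ⟨hZ, hxZ⟩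
        have hxyZ : x ∉ insert y Z := by
          simp only [Set.mem_insert_iff, not_or]; exact ⟨hyx.symm, hxZ⟩
        exact Or.inr ⟨hZ', hyZ, fun h => hdep ((hind Z hxyZ).mpr h)⟩
    · rintro (⟨hZ, -, hyZ, hdep⟩ | ⟨hZ', hyZ, hdep⟩)
      · exact ⟨hZ, hyZ, hdep⟩
      · have hZ : Z ∈ biIndep M (j + 1) ∧ x ∉ Z := by
          have h := hZ'
          rw [← biIndep_filter_notMem_coloop M hx (j + 1)] at h
          exact h
        have hxyZ : x ∉ insert y Z := by
          simp only [Set.mem_insert_iff, not_or]; exact ⟨hyx.symm, hZ.2⟩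
        exact ⟨hZ.1, hyZ, fun h => hdep ((hind Z hxyZ).mp h)⟩
  have hdisj : Disjoint {Z ∈ biIndep M (j + 1) | x ∈ Z ∧ (y ∉ Z ∧ ¬ M.Indep (insert y Z))}
      {Z ∈ biIndep (M.delete {x}) (j + 1) | y ∉ Z ∧ ¬ (M.delete {x}).Indep (insert y Z)} := by
    rw [Set.disjoint_left]
    rintro Z ⟨-, hxZ, -⟩ ⟨hZ', -⟩
    have hZ : Z ∈ biIndep M (j + 1) ∧ x ∉ Z := by
      have h := hZ'
      rw [← biIndep_filter_notMem_coloop M hx (j + 1)] at h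
      exact h
    exact hZ.2 hxZ
  rw [hsplit, Set.ncard_union_eq hdisj (hfin.subset (by rw [hsplit]; exact Set.subset_union_left))
    (hfin.subset (by rw [hsplit]; exact Set.subset_union_right)),
    ncard_biIndep_mem_coloop_eq M hx j (fun Z => y ∉ Z ∧ ¬ M.Indep (insert y Z))]
  congr 2
  ext T
  simp only [Set.mem_setOf_eq, Set.mem_insert_iff, not_or]
  constructor
  · rintro ⟨hT, ⟨-, hyT⟩, hdep⟩
    refine ⟨hT, hyT, fun h => hdep ?_⟩
    have hxT : x ∉ T := fun hxT => (hT.1 hxT).2 (Set.mem_singleton x)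
    have hxyT : x ∉ insert y T := by simp only [Set.mem_insert_iff, not_or]; exact ⟨hyx.symm, hxT⟩
    have h' : M.Indep (insert y T) := (hind T hxyT).mpr h
    have : insert y (insert x T) = insert x (insert y T) := Set.insert_comm y x T
    rw [this]
    exact hx.insert_indep_of_indep h'
  · rintro ⟨hT, hyT, hdep⟩
    refine ⟨hT, ⟨hyx, hyT⟩, fun h => hdep ?_⟩
    have hxT : x ∉ T := fun hxT => (hT.1 hxT).2 (Set.mem_singleton x)
    have hxyT : x ∉ insert y T := by simp only [Set.mem_insert_iff, not_or]; exact ⟨hyx.symm, hxT⟩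
    refine (hind T hxyT).mp (h.subset ?_)
    rw [Set.insert_comm]
    exact Set.subset_insert x _

/-! ## One target for every member, and the members of a `4`-circuit -/

/-- **A target through the complement of every absorbing `3`-set**: for `Z ∈ A^y_3` and `6 ≤ #E` there is a pair
`T ⊆ E ∖ insert y Z` with `W := E ∖ insert y T ∈ A^y_{#E − 3}` and `C_y(W) = C_y(Z)`. In the dual: a basis of
`J = E ∖ insert y Z` has at most two elements; extended to a pair `T ⊆ J` it has `cl✶ T = cl✶ J`, so `insert y T`
spans `M✶`, `W ⊇ Z` spans `M✶`, `T ⊆ J` does not — and the circuit `C_y(Z) ⊆ insert y W` is the circuit of `y`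
in the independent `W`. -/
lemma exists_compl_pair_mem_lowAbsorb {y : α} (hy : y ∈ M.E) (hn : 6 ≤ M.E.ncard) {Z : Set α}
    (hZ : Z ∈ lowAbsorbAt M y 3) :
    ∃ T, T ⊆ M.E \ insert y Z ∧ T.ncard = 2 ∧ M.E \ insert y T ∈ lowAbsorbAt M y (M.E.ncard - 3) ∧
      M.fundCircuit y (M.E \ insert y T) = M.fundCircuit y Z := by
  obtain ⟨hIeq, hIs, hJns, hyJ, hZs, hrank⟩ := absorb_three_dual_facts M hy hZ
  have hycl := mem_closure_of_mem_lowAbsorbAt' M hy hZ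
  obtain ⟨⟨hZE, hZ3, hZi, hcind⟩, hyZ, hdep⟩ := hZ
  have hJE : M.E \ insert y Z ⊆ M.E := Set.sdiff_subset
  have hJfin : (M.E \ insert y Z).Finite := M.ground_finite.subset hJE
  have hJcard := ncard_compl_insert_three M hy hZE hZ3 hyZ
  have hyE' : y ∈ M✶.E := by rwa [Matroid.dual_ground]
  have hJE' : M.E \ insert y Z ⊆ M✶.E := by rwa [Matroid.dual_ground]
  obtain ⟨B, hB⟩ := M✶.exists_isBasis (M.E \ insert y Z) hJE'
  have hBJ : B ⊆ M.E \ insert y Z := hB.subset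
  have hBfin : B.Finite := hJfin.subset hBJ
  have hB2 : B.ncard ≤ 2 := by
    have h1 := eRk_add_one_eq_eRank_of_spanning_insert hyE' hyJ hIs
    have h3 : M✶.eRk (M.E \ insert y Z) = B.encard := hB.eRk_eq_encard
    have h4 : ((B.ncard + 1 : ℕ) : ℕ∞) ≤ ((3 : ℕ) : ℕ∞) := by
      push_cast
      rw [hBfin.cast_ncard_eq, ← h3, h1]
      exact hrank
    have h5 : B.ncard + 1 ≤ 3 := by exact_mod_cast h4
    omega
  obtain ⟨T, hBT, hTJ, hT2⟩ :=
    Set.exists_subsuperset_card_eq hBJ hB2 (by rw [hJcard]; omega)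
  have hclT : M✶.closure T = M✶.closure (M.E \ insert y Z) := by
    refine subset_antisymm (M✶.closure_subset_closure hTJ) ?_
    rw [← hB.closure_eq_closure]
    exact M✶.closure_subset_closure hBT
  have hyT : y ∉ T := fun h => (hTJ h).2 (Set.mem_insert y Z)
  have hTfin : T.Finite := hJfin.subset hTJ
  have hTE : T ⊆ M.E := hTJ.trans hJE
  have hyTE : insert y T ⊆ M.E := Set.insert_subset hy hTE
  have hZW : Z ⊆ M.E \ insert y T := by
    intro x hx
    refine ⟨hZE hx, ?_⟩
    simp only [Set.mem_insert_iff, not_or]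
    exact ⟨fun hxy => hyZ (hxy ▸ hx), fun hxT => (hTJ hxT).2 (Set.mem_insert_of_mem y hx)⟩
  -- `insert y T` spans the dual
  have hyTs : M✶.Spanning (insert y T) := by
    refine ⟨?_, by rw [Matroid.dual_ground]; exact hyTE⟩
    rw [← Matroid.closure_insert_closure_eq_closure_insert, hclT,
      Matroid.closure_insert_closure_eq_closure_insert]
    exact hIs.closure_eq
  have hWs : M✶.Spanning (M.E \ insert y T) :=
    hZs.superset hZW (by rw [Matroid.dual_ground]; exact Set.sdiff_subset)
  have hWi : M.Indep (M.E \ insert y T) := by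
    rw [indep_iff_dual_spanning_compl M Set.sdiff_subset, Set.sdiff_sdiff_cancel_left hyTE]
    exact hyTs
  have hWabs : M.E \ insert y T ∈ lowAbsorbAt M y (M.E.ncard - 3) := by
    refine ⟨⟨Set.sdiff_subset, ?_, hWi, ?_⟩, fun h => h.2 (Set.mem_insert y T), ?_⟩
    · rw [Set.ncard_sdiff hyTE (M.ground_finite.subset hyTE), Set.ncard_insert_of_notMem hyT hTfin, hT2]
    · rw [indep_compl_iff_dual_spanning M Set.sdiff_subset]; exact hWs
    · -- `insert y W = E ∖ T`, whose independence would make `T ⊆ J` span the dual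
      intro hind
      have heq : insert y (M.E \ insert y T) = M.E \ T := by
        ext x
        simp only [Set.mem_insert_iff, Set.mem_sdiff, not_or]
        constructor
        · rintro (rfl | ⟨hxE, -, hxT⟩)
          · exact ⟨hy, hyT⟩
          · exact ⟨hxE, hxT⟩
        · rintro ⟨hxE, hxT⟩
          by_cases hxy : x = y
          · exact Or.inl hxy
          · exact Or.inr ⟨hxE, hxy, hxT⟩
      rw [heq, indep_compl_iff_dual_spanning M hTE] at hind
      exact hJns (hind.superset hTJ hJE')
  refine ⟨T, hTJ, hT2, hWabs, ?_⟩
  have hC : M.IsCircuit (M.fundCircuit y Z) := hZi.fundCircuit_isCircuit hycl hyZ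
  have hsub : M.fundCircuit y Z ⊆ insert y (M.E \ insert y T) :=
    (M.fundCircuit_subset_insert y Z).trans (Set.insert_subset_insert hZW)
  exact (hC.eq_fundCircuit_of_subset hWi hsub).symm

end PercRepro
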